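/-
HODGE LADDER — STAGE 4, row 1 (K3 surfaces: powers): an unconditional printed instance, BY NAME.
Sibling of `CorCM/Stage4Interfaces.lean` (kept separate: that file is at the 400-line limit).
Literature seat hodge-director-lit-stage4, gen 2; companion document
run/shared/lean/pub/hodge-director/STAGE4-ABELIAN-MOTIVIC-TYPE.md (v2, §1 and CHANGES 6).
-/
import Summits.HodgeConjecture.CorCM.Stage4Interfaces
import Literature.AlgebraicGeometry.Surfaces.K3PowersHodgeOfTranscendentalLattice
import HarnessLib

/-!
# Stage 4, row 1 — the target `HC_K3Powers` holds outright for K3 surfaces with `T(S)_ℚ ↪ U³ ⊕ ⟨-m⟩`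

Floccari, Geom. Topol. 30 (2026), Thm. 5.11 (ii), recorded on the real carriers as the Literature named fact
`Surfaces.Floccari2026_hodgeClasses_algebraic_powers_of_K3_of_transcendental_embedding`: for a projective K3
surface `S` whose rational transcendental lattice embeds isometrically into `(U^{⊕3} ⊕ ⟨-m⟩) ⊗ ℚ`, `m > 0`
(read in a marking), the Hodge conjecture holds for EVERY cartesian power `Sᵏ` — i.e. the row-1 target
`CorCM.Stage4.HC_K3Powers` restricted to these (countably many four-dimensional families of) K3 surfaces needs
NOTHING beyond print, in particular not `HC_AV`.  (The same paper's Thm. 3.5 prints the row-1 junction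
`HC_K3Powers_of_KSH` in substance: given the Kuga–Satake–Hodge statement for `S`, "all powers of `S`" ⟺
"all powers of `KS(S)`"; it is not wired here because `KSH_K3` lives in framework `B`.)  Kernel wiring
only; nothing is asserted beyond the named fact taken as a hypothesis.
-/

noncomputable section

open CategoryTheory MonoidalCategory
open Literature.AlgebraicGeometry
open Literature.AlgebraicGeometry.Motives (SchemeOver IsSmoothProjective)
open Literature.AlgebraicGeometry.HodgeTheory
open Literature.AlgebraicGeometry.Surfaces (IsK3Surface)

namespace Summit.HodgeConjecture.CorCM.Stage4

/-- CITE (row 1, unconditional sub-case), kernel wiring: Floccari 2026 Thm. 5.11 (ii) BY NAME gives the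
row-1 target for every power of a projective K3 surface `S` with `T(S)_ℚ ↪ (U^{⊕3} ⊕ ⟨-m⟩)_ℚ`
(hypotheses as in the Literature record: a marking `(η, p)` with the clauses of
`Surfaces.Huybrechts_K3_marking_exists`, and a `ℚ`-linear `ι` isometric and injective on the
transcendental coordinate vectors). [cite: Floccari2026, Thm. 5.11 (§5)] -/
theorem hc_K3Powers_of_transcendental_embedding
    (h : Surfaces.Floccari2026_hodgeClasses_algebraic_powers_of_K3_of_transcendental_embedding)
    {S : SchemeOver ℂ} (hS : IsK3Surface S)
    (η : complexBetti S (2 * 1) ≃ₗ[ℂ] (Surfaces.K3Index → ℂ)) (p : complexBetti S (2 * 2))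
    (hp : p ≠ 0) (hpi : IsIntegralClass p)
    (hgen : ∀ q : complexBetti S (2 * 2), IsIntegralClass q → ∃ n : ℤ, q = n • p)
    (hint : ∀ c : complexBetti S (2 * 1), IsIntegralClass c ↔ ∃ v : Surfaces.K3Index → ℤ, η c = fun i => (v i : ℂ))
    (hcup : ∀ a b : complexBetti S (2 * 1),
      Literature.AlgebraicTopology.SingularHomology.cupProduct (rfl : 2 * 1 + 2 * 1 = 2 * 2) a b =
        Surfaces.k3Form (η a) (η b) • p)
    {m : ℕ} (hm : 0 < m) (ι : (Surfaces.K3Index → ℚ) →ₗ[ℚ] (Surfaces.U3mIndex → ℚ))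
    (hiso : ∀ v w : Surfaces.K3Index → ℚ, Surfaces.IsTranscendentalCoord S η v →
      Surfaces.IsTranscendentalCoord S η w → Surfaces.u3mFormQ m (ι v) (ι w) = Surfaces.k3FormRat v w)
    (hinj : ∀ v : Surfaces.K3Index → ℚ, Surfaces.IsTranscendentalCoord S η v → ι v = 0 → v = 0)
    (k : ℕ) : HodgeConjectureFor (k * 2) (S.pow k) :=
  h S hS η p hp hpi hgen hint hcup m hm ι hiso hinj k


/-- The same, packaged as the row-1 target's shape for ONE such `S`: all powers at once.
[cite: Floccari2026, Thm. 5.11 (§5)] -/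
theorem forall_hc_pow_of_transcendental_embedding
    (h : Surfaces.Floccari2026_hodgeClasses_algebraic_powers_of_K3_of_transcendental_embedding)
    {S : SchemeOver ℂ} (hS : IsK3Surface S)
    (η : complexBetti S (2 * 1) ≃ₗ[ℂ] (Surfaces.K3Index → ℂ)) (p : complexBetti S (2 * 2))
    (hp : p ≠ 0) (hpi : IsIntegralClass p)
    (hgen : ∀ q : complexBetti S (2 * 2), IsIntegralClass q → ∃ n : ℤ, q = n • p)
    (hint : ∀ c : complexBetti S (2 * 1), IsIntegralClass c ↔ ∃ v : Surfaces.K3Index → ℤ, η c = fun i => (v i : ℂ))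
    (hcup : ∀ a b : complexBetti S (2 * 1),
      Literature.AlgebraicTopology.SingularHomology.cupProduct (rfl : 2 * 1 + 2 * 1 = 2 * 2) a b =
        Surfaces.k3Form (η a) (η b) • p)
    {m : ℕ} (hm : 0 < m) (ι : (Surfaces.K3Index → ℚ) →ₗ[ℚ] (Surfaces.U3mIndex → ℚ))
    (hiso : ∀ v w : Surfaces.K3Index → ℚ, Surfaces.IsTranscendentalCoord S η v →
      Surfaces.IsTranscendentalCoord S η w → Surfaces.u3mFormQ m (ι v) (ι w) = Surfaces.k3FormRat v w)
    (hinj : ∀ v : Surfaces.K3Index → ℚ, Surfaces.IsTranscendentalCoord S η v → ι v = 0 → v = 0) :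
    ∀ k : ℕ, HodgeConjectureFor (k * 2) (S.pow k) :=
  fun k ↦ hc_K3Powers_of_transcendental_embedding h hS η p hp hpi hgen hint hcup hm ι hiso hinj k

end Summit.HodgeConjecture.CorCM.Stage4

end
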